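import Summits.Ventures.LatticeQCDFlow.Scoring.FreeFieldUnadjustedLeapfrog
import Summits.Ventures.LatticeQCDFlow.Scoring.CalibrationTruths
import Literature.Probability.FitznerVanDerHofstad2017.NobleCosineSplit
import HarnessLib

/-!
# HMC at fixed trajectory length has `z = 2` on the free field: the acceptance-one skeleton, exactly

HONEST FRAMING: exact (Metropolis-corrected) sampling algorithms for lattice gauge theory;
figures of merit are autocorrelation/cost numbers at stated couplings and volumes; no
continuum-physics claim.  (SCALAR calibration rung S0-A: not a gauge result.)

Venture `LatticeQCDFlow` (cell pub-lqcd), sub-topic `Scoring`; FANOUT row 2 (`s0-phi4`: dynamical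
exponents `z` of the 2D φ⁴ calibration — HMC is one of the three samplers).  NEW WORK of the cell
over Mathlib; nothing is cited as a fact.  Printed counterparts, named only: Kennedy–Pendleton
1991 (mode-by-mode autocorrelations of HMC on the Gaussian model; `z = 2` at fixed trajectory
length, `z = 1` with `T ∝ ξ`, resonances), Mackenzie 1989 (randomised trajectory lengths).

`Scoring/FreeFieldLeapfrog.lean` gave the DICTIONARY for S0-A's fitted HMC exponents as a reading
("each mode of the HMC chain is an AR(1) series with coefficient `cos(Ω_κ T)` … `z = 2` at fixed
`T`") and said it is not a theorem for the Metropolis-corrected chain (the accept step makes the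
regression nonlinear).  For the acceptance-one skeleton — leapfrog WITHOUT the test, whose
invariant law is the shadow Gaussian of `Scoring/FreeFieldUnadjustedLeapfrog.lean`, and to which
the exact chain reduces as `δ → 0` at fixed `T = Nδ` — it IS a theorem, mode by mode, with no
small-`δ` expansion anywhere:

## What is proved (one mode `Ω² = w2`, stable regime `δ²Ω² < 4`, `θ = arccos(1 − δ²Ω²/2)`, `c = cos(Nθ)`)

* §1 `isNegInvariant_volume_real`, `integral_mul_exp_neg_sq_half` — the Gaussian refresh is
  centred: `∫ P e^{−P²/2} dP = 0`.
* §2 **`unadjLeapfrogOp_id`** — the coordinate is an EIGENFUNCTION of the update: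
  `U(id) = c · id` (`E[O' | O] = cos(Nθ) O`: rotation form of the trajectory + centred refresh);
  `unadjLeapfrogOp_const_mul`, **`unadjLeapfrogOp_iterate_id`** — `U^t(id) = c^t · id`;
  `unadjLeapfrogOp_id_of_resonance` — if `cos(Nθ) = 1` the mode observable is FIXED by the update
  (a resonant mode never decorrelates: the reason trajectory lengths are randomised).
* §3 **`unadjusted_autocovariance`** — against ANY initial weight `ρ`:
  `∫ (U^t id)(O)·O·ρ(O) dO = c^t ∫ O² ρ(O) dO` — the mode's autocorrelation function is EXACTLY
  geometric, `ρ(t) = c^t`; hence (`CalibrationTruths.tauInt_geometric`) **`unadjusted_tauInt`** —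
  `τ_int = (1 + c)/(2(1 − c))` (`= ½cot²(Nθ/2)`) whenever `|c| < 1`.
* §4 `one_sub_cos_traj_le` (`1 − c ≤ (Nδ)²Ω²/2`: EXACT one-step phase advance
  `1 − cos θ = δ²Ω²/2` and the elementary `1 − cos(Nx) ≤ N²(1 − cos x)`, reused from the tree's
  `Literature.Probability.FitznerVanDerHofstad2017.one_sub_cos_nat_mul_le`; no Taylor expansion);
  **`unadjusted_tauInt_ge`** —
  `τ_int ≥ (1 + c)/((Nδ)² Ω²)`: at FIXED trajectory length `T = Nδ` the integrated autocorrelation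
  time of a mode of frequency `Ω` is at least `(1 + c)/(T²Ω²)` updates; for the magnetisation
  (`Ω_0² = 2m² = 2/ξ₂²`) **`tauInt_magnetisation_ge`** — `τ_int(M) ≥ (1 + c)·ξ₂²/(2T²)`:
  **`z ≥ 2` at fixed `T`**, for every `δ`, `N` in the stable regime (and `= 2` by the exact
  formula as `mT → 0`).  With `T ∝ ξ` the bound is `O(1)` — the `z = 1` tuning — at the price of the
  resonances of §2 for the other modes.

NOT CLAIMED: the Metropolis-corrected chain's autocorrelations (its regression is not linear; the
skeleton is its `δ → 0`, fixed-`T` limit, acceptance `→ 1`), anything at `λ > 0`, cost accounting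
(force evaluations per update `= N`; the statements are in updates).
-/

namespace Summit.Ventures.LatticeQCDFlow.Scoring

open Real MeasureTheory Filter

/-! ## §1 The Gaussian refresh is centred -/

section Refresh

/-- Lebesgue measure on `ℝ` is symmetric under `P ↦ −P`. -/
theorem isNegInvariant_volume_real : (volume : Measure ℝ).IsNegInvariant :=
  haveI : (volume : Measure ℝ).Regular :=
    Measure.Regular.of_sigmaCompactSpace_of_isLocallyFiniteMeasure _
  Measure.IsAddHaarMeasure.isNegInvariant_of_regular _

/-- `∫ P e^{−P²/2} dP = 0`: the momentum refresh has mean zero. -/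
theorem integral_mul_exp_neg_sq_half : ∫ P : ℝ, P * Real.exp (-(P ^ 2 / 2)) = 0 := by
  haveI := isNegInvariant_volume_real
  have h := integral_neg_eq_self (fun P : ℝ => P * Real.exp (-(P ^ 2 / 2))) volume
  simp only [neg_mul, even_two.neg_pow, integral_neg] at h
  linarith

/-- `P e^{−P²/2}` is integrable. -/
theorem integrable_mul_exp_neg_sq_half : Integrable fun P : ℝ => P * Real.exp (-(P ^ 2 / 2)) := by
  have h := integrable_mul_exp_neg_mul_sq (by norm_num : (0 : ℝ) < 1 / 2)
  refine h.congr (Eventually.of_forall fun P => ?_)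
  simp only
  congr 2
  ring

end Refresh

/-! ## §2 The coordinate is an eigenfunction of the unadjusted update -/

section Eigen

variable {δ w2 : ℝ}

/-- The `O`-component of the trajectory in rotation form:
`O_N = cos(Nθ) O + β sin(Nθ) P` (`lfMode_iterate_rotation`). -/
theorem lfMode_iterate_fst (hδ : 0 < δ) (hw : 0 < w2) (hst : δ ^ 2 * w2 < 4) (O P : ℝ) (N : ℕ) :
    ((lfMode δ w2)^[N] (O, P)).1
      = Real.cos (N * Real.arccos (1 - δ ^ 2 * w2 / 2)) * O
        + δ * (1 - δ ^ 2 * w2 / 4) / Real.sin (Real.arccos (1 - δ ^ 2 * w2 / 2))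
          * Real.sin (N * Real.arccos (1 - δ ^ 2 * w2 / 2)) * P := by
  have h := lfMode_iterate_rotation δ w2 hδ hw hst (O, P) N
  rw [h]

/-- **`E[O' | O] = cos(Nθ)·O`: the coordinate is an eigenfunction of the unadjusted update**, with
eigenvalue `c = cos(Nθ)` — refresh, rotate, keep; the refreshed momentum averages out. -/
theorem unadjLeapfrogOp_id (hδ : 0 < δ) (hw : 0 < w2) (hst : δ ^ 2 * w2 < 4) (N : ℕ) (O : ℝ) :
    unadjLeapfrogOp δ w2 N (fun x => x) O = Real.cos (N * Real.arccos (1 - δ ^ 2 * w2 / 2)) * O := by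
  set c := Real.cos (N * Real.arccos (1 - δ ^ 2 * w2 / 2)) with hc
  set b := δ * (1 - δ ^ 2 * w2 / 4) / Real.sin (Real.arccos (1 - δ ^ 2 * w2 / 2))
    * Real.sin (N * Real.arccos (1 - δ ^ 2 * w2 / 2)) with hb
  have hZ := integral_exp_neg_sq_half_pos
  unfold unadjLeapfrogOp
  have hpt : ∀ P : ℝ, ((lfMode δ w2)^[N] (O, P)).1 * Real.exp (-(P ^ 2 / 2))
      = c * O * Real.exp (-(P ^ 2 / 2)) + b * (P * Real.exp (-(P ^ 2 / 2))) := by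
    intro P
    rw [lfMode_iterate_fst hδ hw hst O P N]
    ring
  simp_rw [hpt]
  rw [integral_add (integrable_exp_neg_sq_half.const_mul _)
    (integrable_mul_exp_neg_sq_half.const_mul _), integral_const_mul, integral_const_mul,
    integral_mul_exp_neg_sq_half, mul_zero, add_zero, mul_div_assoc, div_self hZ.ne', mul_one]

/-- The update is linear: constants pull out. -/
theorem unadjLeapfrogOp_const_mul (δ w2 : ℝ) (N : ℕ) (k : ℝ) (f : ℝ → ℝ) (O : ℝ) :
    unadjLeapfrogOp δ w2 N (fun x => k * f x) O = k * unadjLeapfrogOp δ w2 N f O := by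
  unfold unadjLeapfrogOp
  simp_rw [mul_assoc]
  rw [integral_const_mul, mul_div_assoc]

/-- **`U^t(id) = c^t · id`**: after `t` updates the conditional mean of the mode is `cos(Nθ)^t O`. -/
theorem unadjLeapfrogOp_iterate_id (hδ : 0 < δ) (hw : 0 < w2) (hst : δ ^ 2 * w2 < 4) (N t : ℕ) :
    (unadjLeapfrogOp δ w2 N)^[t] (fun x => x)
      = fun O => Real.cos (N * Real.arccos (1 - δ ^ 2 * w2 / 2)) ^ t * O := by
  induction t with
  | zero =>
      funext O
      simp
  | succ t ih =>
      rw [Function.iterate_succ_apply', ih]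
      funext O
      rw [unadjLeapfrogOp_const_mul, unadjLeapfrogOp_id hδ hw hst, pow_succ]
      ring

/-- **Resonance**: if `cos(Nθ) = 1` (`Nθ ∈ 2πℤ`) the mode observable is FIXED by the update — that
mode of the unadjusted chain never decorrelates, whatever the statistics. -/
theorem unadjLeapfrogOp_id_of_resonance (hδ : 0 < δ) (hw : 0 < w2) (hst : δ ^ 2 * w2 < 4) {N : ℕ}
    (hres : Real.cos (N * Real.arccos (1 - δ ^ 2 * w2 / 2)) = 1) :
    unadjLeapfrogOp δ w2 N (fun x => x) = fun x => x := by
  funext O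
  rw [unadjLeapfrogOp_id hδ hw hst, hres, one_mul]

end Eigen

/-! ## §3 The autocorrelation function is exactly geometric -/

section ACF

variable {δ w2 : ℝ}

/-- **Lag-`t` autocovariance, against ANY initial weight `ρ`**:
`∫ (U^t id)(O) · O · ρ(O) dO = cos(Nθ)^t · ∫ O² ρ(O) dO` — the normalised autocorrelation function
of the mode is `ρ(t) = c^t` exactly (stationary or not). -/
theorem unadjusted_autocovariance (hδ : 0 < δ) (hw : 0 < w2) (hst : δ ^ 2 * w2 < 4) (N t : ℕ)
    (ρ : ℝ → ℝ) :
    ∫ O, (unadjLeapfrogOp δ w2 N)^[t] (fun x => x) O * O * ρ O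
      = Real.cos (N * Real.arccos (1 - δ ^ 2 * w2 / 2)) ^ t * ∫ O, O ^ 2 * ρ O := by
  rw [unadjLeapfrogOp_iterate_id hδ hw hst, ← integral_const_mul]
  refine integral_congr_ae (Eventually.of_forall fun O => ?_)
  simp only
  ring

/-- **`τ_int` of the mode**: with `c = cos(Nθ)`, `|c| < 1`: `τ_int = (1 + c)/(2(1 − c))`
(`= ½cot²(Nθ/2)`), in units of updates. -/
theorem unadjusted_tauInt {N : ℕ}
    (hc : |Real.cos (N * Real.arccos (1 - δ ^ 2 * w2 / 2))| < 1) :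
    tauInt (fun t => Real.cos (N * Real.arccos (1 - δ ^ 2 * w2 / 2)) ^ t)
      = (1 + Real.cos (N * Real.arccos (1 - δ ^ 2 * w2 / 2)))
        / (2 * (1 - Real.cos (N * Real.arccos (1 - δ ^ 2 * w2 / 2)))) :=
  tauInt_geometric hc

end ACF

/-! ## §4 `z = 2` at fixed trajectory length -/

section ZTwo

/-- **One-step phase advance, exactly**: `1 − cos θ = δ²Ω²/2`; hence along a trajectory
`1 − cos(Nθ) ≤ (Nδ)²Ω²/2 = T²Ω²/2` (no expansion in `δ`). -/
theorem one_sub_cos_traj_le {δ w2 : ℝ} (hw : 0 < w2) (hst : δ ^ 2 * w2 < 4) (N : ℕ) :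
    1 - Real.cos (N * Real.arccos (1 - δ ^ 2 * w2 / 2)) ≤ (N * δ) ^ 2 * w2 / 2 := by
  have hδ2 : 0 ≤ δ ^ 2 := sq_nonneg δ
  have ha1 : -1 ≤ 1 - δ ^ 2 * w2 / 2 := by nlinarith
  have ha2 : 1 - δ ^ 2 * w2 / 2 ≤ 1 := by nlinarith
  have h := Literature.Probability.FitznerVanDerHofstad2017.one_sub_cos_nat_mul_le N
    (Real.arccos (1 - δ ^ 2 * w2 / 2))
  rw [Real.cos_arccos ha1 ha2] at h
  calc 1 - Real.cos (N * Real.arccos (1 - δ ^ 2 * w2 / 2))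
      ≤ (N : ℝ) ^ 2 * (1 - (1 - δ ^ 2 * w2 / 2)) := h
    _ = (N * δ) ^ 2 * w2 / 2 := by ring

/-- **`z = 2` AT FIXED TRAJECTORY LENGTH (lower bound, exact regime).**  For a mode of frequency
`Ω²` and trajectories of `N ≥ 1` steps of size `δ` (`T = Nδ`), whenever `|c| < 1`:
`τ_int ≥ (1 + c)/(T² Ω²)` updates. -/
theorem unadjusted_tauInt_ge {δ w2 : ℝ} (hδ : 0 < δ) (hw : 0 < w2) (hst : δ ^ 2 * w2 < 4) {N : ℕ}
    (hN : 1 ≤ N) (hc : |Real.cos (N * Real.arccos (1 - δ ^ 2 * w2 / 2))| < 1) :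
    (1 + Real.cos (N * Real.arccos (1 - δ ^ 2 * w2 / 2))) / ((N * δ) ^ 2 * w2)
      ≤ tauInt (fun t => Real.cos (N * Real.arccos (1 - δ ^ 2 * w2 / 2)) ^ t) := by
  set c := Real.cos (N * Real.arccos (1 - δ ^ 2 * w2 / 2)) with hc_def
  rw [unadjusted_tauInt hc]
  have hc1 : c < 1 := (abs_lt.mp hc).2
  have hcm : -1 < c := (abs_lt.mp hc).1
  have hnum : 0 ≤ 1 + c := by linarith
  have hden : 0 < 2 * (1 - c) := by linarith
  have hN' : (1 : ℝ) ≤ N := by exact_mod_cast hN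
  have hT : 0 < (N * δ) ^ 2 * w2 := by positivity
  have hle : 2 * (1 - c) ≤ (N * δ) ^ 2 * w2 := by
    have := one_sub_cos_traj_le hw hst N
    linarith
  exact div_le_div_of_nonneg_left hnum hden hle

/-- **The magnetisation mode** (`Ω_0² = 2m²`, `ξ₂² = 1/m²`): `τ_int(M) ≥ (1 + c)·ξ₂²/(2T²)` — at fixed
trajectory length the slowest mode's autocorrelation time grows at least like `ξ₂²`: `z ≥ 2`. -/
theorem tauInt_magnetisation_ge {δ m2 : ℝ} (hδ : 0 < δ) (hm : 0 < m2) (hst : δ ^ 2 * (2 * m2) < 4)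
    {N : ℕ} (hN : 1 ≤ N) (hc : |Real.cos (N * Real.arccos (1 - δ ^ 2 * (2 * m2) / 2))| < 1) :
    (1 + Real.cos (N * Real.arccos (1 - δ ^ 2 * (2 * m2) / 2))) * (1 / m2) / (2 * (N * δ) ^ 2)
      ≤ tauInt (fun t => Real.cos (N * Real.arccos (1 - δ ^ 2 * (2 * m2) / 2)) ^ t) := by
  have h := unadjusted_tauInt_ge hδ (by linarith : 0 < 2 * m2) hst hN hc
  have e : (1 + Real.cos (N * Real.arccos (1 - δ ^ 2 * (2 * m2) / 2))) * (1 / m2)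
      / (2 * (N * δ) ^ 2)
      = (1 + Real.cos (N * Real.arccos (1 - δ ^ 2 * (2 * m2) / 2))) / ((N * δ) ^ 2 * (2 * m2)) := by
    field_simp
  rw [e]
  exact h

end ZTwo

end Summit.Ventures.LatticeQCDFlow.Scoring
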